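import Literature.NumberTheory.EllipticCurves.Rank1Residual.GVParityTwistTransportProofs
import Literature.NumberTheory.EllipticCurves.DivisionFieldReducibleBorelCyclotomic
import HarnessLib

/-!
# A rational line fixed by `Gal(ℚ̄/ℚ(μ_p))` passes along every `ℚ`-isogeny (the cyclotomic-Borel condition is an
# isogeny-class invariant) — theorems only

Topic `NumberTheory/EllipticCurves/Rank1Residual` (namespace = path).  Theorem-only file (no definition, no named fact,
no `sorry`), written by the prover seat `bsd-potss-rkm` g35 (cell `bsd-potss`; `--supports` stmt-BirchSwinnertonDyer-19196,
crux M `ReducibleKatoMember`; closes nothing).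

WHY.  Crux M's chain reads Coates–Sujatha's statement (A) at KATO'S MEMBER `W_K` of the isogeny class (the member the hull
package `exists_memberHullZetaFineInputs` produces), not at the listed curve `W`.  The FW-free (A) of this seat
(`Theorems/…ReducibleFineSelmerBorelCyclotomic`, `…RationalTorsion`) needs a rational line `Φ ≤ E[p]` fixed pointwise by
`Gal(ℚ̄/L)`, `L ⊆ ℚ̄` the `p`-th cyclotomic field.  This file shows that such a line PASSES ALONG EVERY `ℚ`-ISOGENY, so the
hypothesis can be checked at ANY member of the class (e.g. at the curve with the rational `p`-torsion point) and used at `W_K`: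

* `exists_isRationalLine_fixedBy_of_isogeny` — along an isogeny `f : E₁ → E₂` not killing `E₁[p]` (the case analysis of the
  tree's `exists_isRationalLine_of_isogeny`): if `f` is injective on `Φ`, its image is such a line (equivariance); otherwise
  `ker(f|E₁[p]) = Φ` (two lines sharing a point), the image `f(E₁[p]) ≅ E₁[p]/Φ` is a rational line, and `Gal(ℚ̄/L)` acts
  trivially on `E₁[p]/Φ` because `χ₂ = ω χ₁⁻¹` — the Weil-pairing bridge
  `WeierstrassCurve.mem_borelKernel_of_mem_fixingSubgroup_of_forall_smul_eq` (this seat, `DivisionFieldReducibleBorelCyclotomic`).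
* `exists_isRationalLine_fixedBy_of_isIsogenous` — class form (`exists_isogeny_apply_ne_zero`: some isogeny does not kill `E[p]`).
* (private) `isCyclotomicExtension_rat_transport` — the two `ℚ`-algebra structures on a subfield of `ℚ̄` (`algebraRat` vs
  the `IntermediateField` one) carry the same `IsCyclotomicExtension` predicate (`Subsingleton (Algebra ℚ L)`); bookkeeping
  used to feed the bridge (stated over a general base field) at `K = ℚ`.

NOTE: a line of RATIONAL `p`-torsion (`χ₁ = 1`) does NOT pass along every isogeny as such (`E/⟨P⟩` carries `μ_p`, `χ₁ = ω`);
the `Gal(ℚ̄/ℚ(μ_p))`-fixed condition is the isogeny-invariant envelope of both.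

References: [SilvermanAEC2009] III.4 (isogenies), Prop. III.8.1 (Weil pairing), Cor. III.6.4 (b); [Serre1972] §4 (Borel image);
[Wuthrich2014] Lemma 14 (p. 396).
-/

noncomputable section

open scoped Classical

open WeierstrassCurve Literature.NumberTheory.EllipticCurves Literature.NumberTheory.GaloisRepresentations
open Field IntermediateField

namespace Literature.NumberTheory.EllipticCurves.Rank1Residual

variable {W W' : WeierstrassCurve ℚ} [W.IsElliptic] [W'.IsElliptic] {p : ℕ} [Fact p.Prime]

/-- The two `ℚ`-algebra structures on a field (`algebraRat` and any other) carry the same cyclotomic predicate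
(`Subsingleton (Algebra ℚ L)`); private plumbing (the Summits twin is
`ReducibleFineSelmerRationalTorsion.isCyclotomicExtension_rat_transport`). [folklore] -/
private theorem isCyclotomicExtension_rat_transport {S : Set ℕ} {L : Type} [Field L]
    {i₁ : Algebra ℚ L} (i₂ : Algebra ℚ L) (h : @IsCyclotomicExtension S ℚ L _ _ i₁) :
    @IsCyclotomicExtension S ℚ L _ _ i₂ := by
  obtain rfl : i₁ = i₂ := Subsingleton.elim _ _
  exact h

/-- A rational line is neither `0` nor `E[p]` (its order is `p`, `#E[p] = p²`). [cite: SilvermanAEC2009, Cor. III.6.4 (b)] -/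
theorem IsRationalLine.ne_bot_and_ne_top {Φ : AddSubgroup (geomTorsion W (p : ℤ))} (hΦ : IsRationalLine W p Φ) :
    Φ ≠ ⊥ ∧ Φ ≠ ⊤ := by
  have hp : p.Prime := Fact.out
  have hE : Nat.card (geomTorsion W (p : ℤ)) = p ^ 2 := natCard_geomTorsion W p
  refine ⟨fun h => ?_, fun h => ?_⟩
  · have h1 : Nat.card Φ = 1 := by rw [h]; exact AddSubgroup.card_bot
    rw [hΦ.1] at h1
    exact hp.one_lt.ne' h1
  · have h2 : Nat.card Φ = p ^ 2 := by rw [h, AddSubgroup.card_top, hE]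
    rw [hΦ.1] at h2
    have : p < p ^ 2 := by nlinarith [hp.one_lt]
    omega

omit [W'.IsElliptic] in
/-- **A rational line fixed pointwise by `Gal(ℚ̄/L)` (`L ⊆ ℚ̄` a `p`-th cyclotomic field) passes along an isogeny not
killing `E[p]`.**  If `f : E₁ → E₂` is a `ℚ`-isogeny with `E₁[p] ⊄ ker f` and `Φ ≤ E₁[p]` is a rational line on which
`Gal(ℚ̄/L)` acts trivially, then `E₂[p]` has a rational line on which `Gal(ℚ̄/L)` acts trivially: the image of `Φ` if `f` is
injective on `Φ`, else the image `f(E₁[p]) ≅ E₁[p]/Φ`, on which `Gal(ℚ̄/L)` acts trivially by the Weil pairing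
(`χ₂ = ω χ₁⁻¹`). [cite: SilvermanAEC2009, Prop. III.8.1 and III.4] [cite: Serre1972, §4 (Borel image: χ₁χ₂ = χ)] -/
theorem exists_isRationalLine_fixedBy_of_isogeny (f : Isogeny W W')
    (hf : ∃ P : geomPoints W, P ∈ geomTorsion W (p : ℤ) ∧ f P ≠ 0)
    {Φ : AddSubgroup (geomTorsion W (p : ℤ))} (hΦ : IsRationalLine W p Φ)
    (L : IntermediateField ℚ (AlgebraicClosure ℚ)) [hL : IsCyclotomicExtension {p} ℚ L]
    (hΦL : ∀ σ : absoluteGaloisGroup ℚ, σ ∈ (L.fixingSubgroup : Subgroup (absoluteGaloisGroup ℚ)) →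
      ∀ x : geomTorsion W (p : ℤ), x ∈ Φ → σ • x = x) :
    ∃ Ψ : AddSubgroup (geomTorsion W' (p : ℤ)), IsRationalLine W' p Ψ ∧
      ∀ σ : absoluteGaloisGroup ℚ, σ ∈ (L.fixingSubgroup : Subgroup (absoluteGaloisGroup ℚ)) →
        ∀ y : geomTorsion W' (p : ℤ), y ∈ Ψ → σ • y = y := by
  have hp : p.Prime := Fact.out
  -- the induced equivariant homomorphism `g : E[p] → E'[p]` (as in `exists_isRationalLine_of_isogeny`)
  have hmem : ∀ P : geomTorsion W (p : ℤ), f (P : geomPoints W) ∈ geomTorsion W' (p : ℤ) := by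
    intro P
    have h0 : (p : ℤ) • (P : geomPoints W) = 0 := (Submodule.mem_torsionBy_iff (p : ℤ) _).mp P.2
    have h1 : (p : ℤ) • f (P : geomPoints W) = 0 := by rw [← map_zsmul, h0, map_zero]
    exact (Submodule.mem_torsionBy_iff (p : ℤ) _).mpr h1
  let g : geomTorsion W (p : ℤ) →+ geomTorsion W' (p : ℤ) :=
    { toFun := fun P ↦ ⟨f (P : geomPoints W), hmem P⟩
      map_zero' := Subtype.ext (by simp)
      map_add' := fun P Q ↦ Subtype.ext (by simp) }
  have hgval : ∀ P : geomTorsion W (p : ℤ), (g P : geomPoints W') = f (P : geomPoints W) := fun _ ↦ rfl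
  have hg : ∀ (σ : absoluteGaloisGroup ℚ) (P : geomTorsion W (p : ℤ)), g (σ • P) = σ • g P := by
    intro σ P
    apply Subtype.ext
    rw [hgval, AddSubgroup.torsionBy.coe_smul, AddSubgroup.torsionBy.coe_smul, hgval, f.map_smul]
  have hE : Nat.card (geomTorsion W (p : ℤ)) = p ^ 2 := natCard_geomTorsion W p
  haveI : Finite (geomTorsion W (p : ℤ)) :=
    Nat.finite_of_card_ne_zero (by rw [hE]; exact pow_ne_zero 2 hp.ne_zero)
  by_cases hinj : ∀ P ∈ Φ, g P = 0 → P = 0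
  · -- `g` injective on `Φ`: the image line, fixed by equivariance
    refine ⟨Φ.map g, isRationalLine_map g hg hΦ hinj, fun σ hσ y hy => ?_⟩
    obtain ⟨x, hx, rfl⟩ := AddSubgroup.mem_map.mp hy
    rw [← hg, hΦL σ hσ x hx]
  · push Not at hinj
    obtain ⟨P₁, hP₁Φ, hP₁g, hP₁0⟩ := hinj
    have hP₁K : P₁ ∈ g.ker := (AddMonoidHom.mem_ker).mpr hP₁g
    have hdvd : Nat.card g.ker ∣ p ^ 2 := hE ▸ g.ker.card_addSubgroup_dvd_card
    obtain ⟨i, hi, hKi⟩ := (Nat.dvd_prime_pow hp).mp hdvd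
    interval_cases i
    · exfalso
      have hbot : g.ker = ⊥ := AddSubgroup.card_eq_one.mp (by simpa using hKi)
      rw [hbot, AddSubgroup.mem_bot] at hP₁K
      exact hP₁0 hP₁K
    · -- `ker g` is a line containing `P₁ ∈ Φ ∖ 0`, hence `ker g = Φ`; the image is `E[p]/Φ`
      have hK : Nat.card g.ker = p := by simpa using hKi
      refine ⟨g.range, isRationalLine_range g hg hE hK, fun σ hσ y hy => ?_⟩
      obtain ⟨x, rfl⟩ := AddMonoidHom.mem_range.mp hy
      have hΦker : Φ = g.ker := by
        rcases line_eq_or_inf_eq_bot hΦ.1 hK with h | h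
        · exact h
        · exfalso
          have : P₁ ∈ Φ ⊓ g.ker := ⟨hP₁Φ, hP₁K⟩
          rw [h, AddSubgroup.mem_bot] at this
          exact hP₁0 this
      -- `σ ∈ Gal(ℚ̄/L)` acts trivially on `E[p]/Φ` (Weil pairing: `χ₂ = ω χ₁⁻¹`)
      obtain ⟨h1, h2⟩ := hΦ.ne_bot_and_ne_top
      have hbridge := @WeierstrassCurve.mem_borelKernel_of_mem_fixingSubgroup_of_forall_smul_eq ℚ _ _ W p _ _ Φ h1 h2 L
        (isCyclotomicExtension_rat_transport _ hL) hΦL σ hσ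
      obtain ⟨-, hquot⟩ := (WeierstrassCurve.mem_borelKernel_iff (W := W)).mp hbridge
      have hker : σ • x - x ∈ g.ker := hΦker ▸ hquot x
      rw [AddMonoidHom.mem_ker, map_sub, sub_eq_zero, hg] at hker
      exact hker
    · exfalso
      have htop : g.ker = ⊤ := AddSubgroup.eq_top_of_card_eq _ (by rw [hKi, hE])
      obtain ⟨P, hP, hfP⟩ := hf
      have hmem1 : (⟨P, hP⟩ : geomTorsion W (p : ℤ)) ∈ g.ker := by rw [htop]; exact AddSubgroup.mem_top _
      rw [AddMonoidHom.mem_ker] at hmem1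
      exact hfP (by simpa [hgval] using congrArg Subtype.val hmem1)

omit [W'.IsElliptic] in
/-- **The cyclotomic-Borel condition is an isogeny-class invariant**: if `E ∼ E'` over `ℚ` and `E[p]` has a rational line fixed
pointwise by `Gal(ℚ̄/L)` (`L ⊆ ℚ̄` a `p`-th cyclotomic field), so does `E'[p]`. [cite: SilvermanAEC2009, Prop. III.8.1 and III.4]
[cite: Serre1972, §4 (Borel image: χ₁χ₂ = χ)] -/
theorem exists_isRationalLine_fixedBy_of_isIsogenous (h : IsIsogenous W W')
    {Φ : AddSubgroup (geomTorsion W (p : ℤ))} (hΦ : IsRationalLine W p Φ)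
    (L : IntermediateField ℚ (AlgebraicClosure ℚ)) [IsCyclotomicExtension {p} ℚ L]
    (hΦL : ∀ σ : absoluteGaloisGroup ℚ, σ ∈ (L.fixingSubgroup : Subgroup (absoluteGaloisGroup ℚ)) →
      ∀ x : geomTorsion W (p : ℤ), x ∈ Φ → σ • x = x) :
    ∃ Ψ : AddSubgroup (geomTorsion W' (p : ℤ)), IsRationalLine W' p Ψ ∧
      ∀ σ : absoluteGaloisGroup ℚ, σ ∈ (L.fixingSubgroup : Subgroup (absoluteGaloisGroup ℚ)) →
        ∀ y : geomTorsion W' (p : ℤ), y ∈ Ψ → σ • y = y := by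
  obtain ⟨f, P, hP, hfP⟩ := exists_isogeny_apply_ne_zero (p := p) h
  exact exists_isRationalLine_fixedBy_of_isogeny f ⟨P, hP, hfP⟩ hΦ L hΦL

omit [W'.IsElliptic] in
/-- **A non-zero `Γ_ℚ`-fixed point of `E[p]` gives, on EVERY curve isogenous to `E`, a rational line fixed pointwise by
`Gal(ℚ̄/L)`** (`L ⊆ ℚ̄` any `p`-th cyclotomic field): the line `ℤQ` is rational and `Γ_ℚ`-fixed, and the cyclotomic-Borel
condition passes along the isogeny. [cite: SilvermanAEC2009, Prop. III.8.1 and III.4] [cite: Serre1972, §4] -/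
theorem exists_isRationalLine_fixedBy_of_isIsogenous_of_fixed_point (h : IsIsogenous W W')
    (Q : geomTorsion W (p : ℤ)) (hQ0 : Q ≠ 0) (hQfix : ∀ σ : absoluteGaloisGroup ℚ, σ • Q = Q)
    (L : IntermediateField ℚ (AlgebraicClosure ℚ)) [IsCyclotomicExtension {p} ℚ L] :
    ∃ Ψ : AddSubgroup (geomTorsion W' (p : ℤ)), IsRationalLine W' p Ψ ∧
      ∀ σ : absoluteGaloisGroup ℚ, σ ∈ (L.fixingSubgroup : Subgroup (absoluteGaloisGroup ℚ)) →
        ∀ y : geomTorsion W' (p : ℤ), y ∈ Ψ → σ • y = y := by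
  have hp : p.Prime := Fact.out
  have hE : Nat.card (geomTorsion W (p : ℤ)) = p ^ 2 := natCard_geomTorsion W p
  haveI : Finite (geomTorsion W (p : ℤ)) :=
    Nat.finite_of_card_ne_zero (by rw [hE]; exact pow_ne_zero 2 hp.ne_zero)
  -- the line `ℤQ`: order `p` (it divides `p` and is not `1`), `Γ_ℚ`-fixed pointwise
  have hQp : p • Q = 0 := by
    apply Subtype.ext
    rw [AddSubgroupClass.coe_nsmul, ZeroMemClass.coe_zero, ← natCast_zsmul]
    exact (Submodule.mem_torsionBy_iff (p : ℤ) _).mp Q.2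
  have hord : addOrderOf Q = p :=
    (hp.eq_one_or_self_of_dvd _ (addOrderOf_dvd_of_nsmul_eq_zero hQp)).resolve_left
      (fun h1 => hQ0 (AddMonoid.addOrderOf_eq_one_iff.mp h1))
  have hfixΦ : ∀ (σ : absoluteGaloisGroup ℚ) (x : geomTorsion W (p : ℤ)),
      x ∈ AddSubgroup.zmultiples Q → σ • x = x := by
    intro σ x hx
    obtain ⟨k, rfl⟩ := AddSubgroup.mem_zmultiples_iff.mp hx
    rw [show σ • (k • Q) = k • (σ • Q) from map_zsmul (DistribSMul.toAddMonoidHom _ σ) k Q, hQfix]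
  have hΦ : IsRationalLine W p (AddSubgroup.zmultiples Q) :=
    ⟨by rw [Nat.card_zmultiples, hord], fun σ x hx => by rw [hfixΦ σ x hx]; exact hx⟩
  exact exists_isRationalLine_fixedBy_of_isIsogenous h hΦ L fun σ _ x hx => hfixΦ σ x hx

end Literature.NumberTheory.EllipticCurves.Rank1Residual

end
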